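import Literature.NumberTheory.ComplexMultiplication.CMBalancedDivisorOfPolarisedStructure
import Literature.NumberTheory.ComplexMultiplication.CMFieldBalancedWeights
import Literature.AlgebraicGeometry.Motives.ComplexTorusAlgebraicHomomorphisms
import Literature.AlgebraicGeometry.Motives.AbelianVarietyProjectiveChart
import Literature.AlgebraicGeometry.Motives.AbelianVarietyPoincareSplitting
import Literature.AlgebraicGeometry.Motives.TateAbelianFiniteLatticeProofs
import Mathlib.RingTheory.Ideal.Norm.AbsNorm
import HarnessLib

/-!
# Row II-1-S5b IS A THEOREM: the `K`-balanced non-degenerate divisor over a finite extension, by AVERAGING an ample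
# divisor over a balanced system of weights of the CM field (Shimura 1998 §6.2 Thm. 4 (3); van Geemen / Deligne 1982 §4)

Topic `Literature/NumberTheory/ComplexMultiplication`, namespace `Literature.NumberTheory.ComplexMultiplication`.
THEOREMS ONLY (no definition, no instance, no named fact).  Cell `hodgecm-mathlib` (D-0151), h21 line
`b2-main-theorem-cm` (`stub_balancedDivisor`), B-typ02's read-first of 2026-08-28T08:05:08Z «S5b is provable tonight,
purely algebraically», crew H-alg (B-p06, the weights) + H-div/assembly (A-p02, this file).

THE MATHEMATICS.  Let `(A₀, ι₀)` be of CM type `(K, Φ)` over a number field `L ⊂ ℂ`, `A₁ := A₀ ⊗_L L′` for a finite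
`L′ ⊂ ℂ` (any; we take `L′ = ⊥`), `ι₁ := ι₀ ⊗ L′`, and let `X₀` be ANY ample divisor on `A₁` ([GortzWedhorn2023] Rem. 27.185,
tree `exists_isAmple_symmetric_holds`).  A **balanced system of weights** of the CM field `K` is a finite family
`ε_j ∈ 𝓞_K ∖ 0`, `m_j ∈ ℕ_{>0}` with
`Σ_j m_j β(ε_j a, ε_j) = Σ_j m_j β(ε_j, ε_j ā)` for every `ℤ`-bilinear `β` on `𝓞_K` and every `a` ([Deligne1982] §4, (4.3)(a) /
[vanGeemen1994] 5.2: the orthogonal idempotent of the component `{τ₂ = τ₁ ∘ ρ}` of `K ⊗_ℚ K`; the tree's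
`exists_sq_weights_of_involution`, packaged by H-alg as `IsCMField.exists_balancedWeights` — taken here as the HYPOTHESIS
`hW` until that file lands).  Put **`X := Σ_j m_j • ι₁(ε_j)^* X₀`** (each `ι₁(ε_j)` is an isogeny: `ε_j ε′_j = N(ε_j) ≠ 0`).
Then on `A := A₁ ⊗ ℂ` with `ι := ι₁ ⊗ ℂ`, Mumford §20 (3) `ē^{f^*Θ}(P,Q) = ē^Θ(fP,fQ)` and the bilinearity of `ē` in the
divisor give `ē^{X_ℂ}(P, Q) = Π_j ē^{X₀,ℂ}(ι(ε_j)P, ι(ε_j)Q)^{m_j}`, so that (bal) `ē^{X_ℂ}(ι(a)P, Q) = ē^{X_ℂ}(P, ι(ā)Q)` IS the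
weight identity for the bi-multiplicative `β(x, y) := ē^{X₀,ℂ}(ι(x)P, ι(y)Q)`; and `X` is AMPLE (sum of pullbacks of an ample
divisor along finite morphisms), hence (nd) by [Lang1983AbelianVarieties] VII §2 Prop. 4 (tree
`exists_radical_pow_eq_one_of_isAmple`).  This is [Shimura1998] §6.2 Thm. 4 (3) («`E(z, T(ξ)w) = E(T(ξ^ρ)z, w)`») with
§4.1 Prop. 10, proved without the analytic Riemann form: the Rosati involution of the averaged polarisation induces `ρ`
on `ι(K)` by construction.

## References
* [Shimura1998] G. Shimura, *Abelian Varieties with Complex Multiplication and Modular Functions* (1998), §6.2 Thm. 4 (3)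
  (p. 45), §4.1 Prop. 10 (p. 23), §18.4 (18.4b) (p. 126).
* [Deligne1982] P. Deligne, *Hodge cycles on abelian varieties*, LNM 900 (1982), §4, (4.3)(a), Lemma 4.7.
* [vanGeemen1994] B. van Geemen, *An introduction to the Hodge conjecture for abelian varieties* (1994), 5.2.
* [MumfordAV1970] D. Mumford, *Abelian Varieties* (1970), §20 (3) (p. 186), §6 Application 3 (p. 64).
* [Lang1983AbelianVarieties] S. Lang, *Abelian Varieties*, Ch. VII §2 Props. 3–4.
-/

set_option autoImplicit false

noncomputable section

open scoped nonZeroDivisors NumberField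
open CategoryTheory CategoryTheory.Limits NumberField AlgebraicGeometry

namespace Literature.NumberTheory.ComplexMultiplication

open Literature.AlgebraicGeometry.Motives Literature.AlgebraicGeometry.Motives.AbelianVariety

/-! ## §1 The multiplications `ι(ε)`, `ε ≠ 0`, are isogenies -/

section Isogeny

variable {K : Type} [Field K] [NumberField K] {k : Type} [Field k] (A : AbelianVariety k) (ι : 𝓞 K →+* End A)

/-- **`ι(ε)` is an isogeny for `ε ∈ 𝓞_K ∖ 0`**: with `n := N(ε 𝓞_K) ∈ ℕ ∖ 0` and `ε′ ε = n` (`N(𝔞) ∈ 𝔞`, Mathlib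
`Ideal.absNorm_mem`), `ι(ε′) ∘ ι(ε) = ι(ε) ∘ ι(ε′) = [n]`, an isogeny ([MumfordAV1970] §6 Application 3), so `ι(ε)` is one
(surjective from `[n] = ι(ε′) ≫ ι(ε)`, finite from `ι(ε) ≫ ι(ε′) = [n]`). [cite: MumfordAV1970, §6 Application 3 (p. 64); §19 Cor. 2 of Thm. 1]
[cite: Shimura1998, §5.1 Prop. 1 and Prop. 3] -/
theorem isIsogeny_map_of_ne_zero {ε : 𝓞 K} (hε : ε ≠ 0) : IsIsogeny (ι ε : A ⟶ A) := by
  classical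
  set n : ℕ := Ideal.absNorm (Ideal.span ({ε} : Set (𝓞 K))) with hn
  have hn0 : n ≠ 0 := by
    rw [hn, Ne, Ideal.absNorm_eq_zero_iff, Ideal.span_singleton_eq_bot]
    exact hε
  obtain ⟨c, hc⟩ : ∃ c : 𝓞 K, c * ε = (n : 𝓞 K) :=
    Ideal.mem_span_singleton'.1 (Ideal.absNorm_mem (Ideal.span ({ε} : Set (𝓞 K))))
  have hιn : (ι (n : 𝓞 K) : A ⟶ A) = n • 𝟙 A := by
    rw [map_natCast, ← Nat.smul_one_eq_cast]
    rfl
  have h1 : (ι c : A ⟶ A) ≫ (ι ε : A ⟶ A) = n • 𝟙 A := by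
    rw [← hιn, ← hc, mul_comm, map_mul]
    rfl
  have h2 : (ι ε : A ⟶ A) ≫ (ι c : A ⟶ A) = n • 𝟙 A := by
    rw [← hιn, ← hc, map_mul]
    rfl
  exact isIsogeny_of_comp_eq_of_comp_eq (isIsogeny_nsmul_id_of_ne_zero A hn0) (isIsogeny_nsmul_id_of_ne_zero A hn0) h1 h2

end Isogeny

/-! ## §2 The action of `𝓞_K` on torsion points: additivity and multiplicativity -/

section Points

variable {K : Type} [Field K] {k : Type} [Field k] {A : AbelianVariety k} (ι : 𝓞 K →+* End A)
  {F : Type} [Field F] [Algebra k F]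

/-- `ι(x + y) P = ι(x) P · ι(y) P` on points ([MumfordAV1970] §19: addition of homomorphisms is pointwise).
[cite: MumfordAV1970, §19 (first paragraph)] -/
theorem map_hom_map_add (x y : 𝓞 K) (P : A.Points F) :
    AlgPoints.map (ι (x + y) : A ⟶ A).hom.hom.hom P =
      AlgPoints.map (ι x : A ⟶ A).hom.hom.hom P * AlgPoints.map (ι y : A ⟶ A).hom.hom.hom P := by
  rw [map_add]
  exact map_hom_add (ι x : A ⟶ A) (ι y : A ⟶ A) P

/-- `ι(x y) P = ι(x) (ι(y) P)` on points (`ι` is a ring homomorphism, `End` multiplies by composition).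
[cite: MumfordAV1970, §19 (first paragraph)] -/
theorem map_hom_map_mul (x y : 𝓞 K) (P : A.Points F) :
    AlgPoints.map (ι (x * y) : A ⟶ A).hom.hom.hom P =
      AlgPoints.map (ι x : A ⟶ A).hom.hom.hom (AlgPoints.map (ι y : A ⟶ A).hom.hom.hom P) := by
  rw [map_mul, End.mul_def]
  exact map_hom_comp (ι y : A ⟶ A) (ι x : A ⟶ A) P

end Points

/-! ## §3 The averaged divisor and its complex Weil pairings -/

section Averaging

variable {K : Type} [Field K] [NumberField K] {k' : Type} [Field k'] [Algebra k' ℂ]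
  (A₁ : AbelianVariety k') (ι₁ : 𝓞 K →+* End A₁)
  (πA : (A₁.baseChange ℂ).X.left ⟶ A₁.X.left) (hπA : πA = pullback.fst A₁.X.hom (bcSpec k' ℂ)) [IsDominant πA]
  (X₀ : CartierDivisor A₁.X.left)

/-- `n • D ∼ n • E` (same divisor) if `D ∼ E`. [folklore] -/
private theorem sameDivisor_smul {X : Scheme.{0}} [IsIntegral X] {D E : CartierDivisor X} (h : D.SameDivisor E) (n : ℕ) :
    (n • D).SameDivisor (n • E) := fun i j x hi hj => by
  rw [CartierDivisor.smul_f, CartierDivisor.smul_f, ← div_pow]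
  exact (h i j x hi hj).pow n

include hπA in
/-- **One summand**: for `ε ≠ 0` and `m`, the divisor `m • ι₁(ε)^* X₀` on `A₁` pulls back to `A₁ ⊗ ℂ` to a divisor with
`ē(P, Q) = ē^{X₀,ℂ}(ι(ε)P, ι(ε)Q)^m` ([MumfordAV1970] §20 (3) along the isogeny `ι(ε) ⊗ ℂ`, and `ē^{mΘ} = (ē^Θ)^m`); it is
ample if `X₀` is and `0 < m`. [cite: MumfordAV1970, §20 (3) (p. 186)] [cite: Lang1983AbelianVarieties, Ch. VII §2 Prop. 3] -/
theorem weilPairingLevel_pullback_smul_pullback_map {ε : 𝓞 K} (hε : ε ≠ 0) (m : ℕ)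
    {N : ℕ} [IsDominant (Hom.toSchemeHom ((N : ℤ) • 𝟙 (A₁.baseChange ℂ)))]
    (P Q : (A₁.baseChange ℂ).torsionPoints ℂ N) :
    haveI := (isIsogeny_map_of_ne_zero A₁ ι₁ hε).isDominant_toSchemeHom
    (A₁.baseChange ℂ).weilPairingLevel ((m • X₀.pullback (Hom.toSchemeHom (ι₁ ε : A₁ ⟶ A₁))).pullback πA) P Q =
      (A₁.baseChange ℂ).weilPairingLevel (X₀.pullback πA)
          ⟨AlgPoints.map (((A₁.endBaseChange ℂ).comp ι₁) ε : A₁.baseChange ℂ ⟶ A₁.baseChange ℂ).hom.hom.hom P.1,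
            map_mem_torsionPoints (((A₁.endBaseChange ℂ).comp ι₁) ε : A₁.baseChange ℂ ⟶ A₁.baseChange ℂ) P.2⟩
          ⟨AlgPoints.map (((A₁.endBaseChange ℂ).comp ι₁) ε : A₁.baseChange ℂ ⟶ A₁.baseChange ℂ).hom.hom.hom Q.1,
            map_mem_torsionPoints (((A₁.endBaseChange ℂ).comp ι₁) ε : A₁.baseChange ℂ ⟶ A₁.baseChange ℂ) Q.2⟩ ^ m := by
  have hiso := isIsogeny_map_of_ne_zero A₁ ι₁ hε
  haveI := hiso.isDominant_toSchemeHom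
  haveI : IsDominant (Hom.toSchemeHom (Hom.baseChange ℂ (ι₁ ε : A₁ ⟶ A₁))) := hiso.isDominant_toSchemeHom_baseChange ℂ
  -- `(m • ι(ε)^*X₀)_ℂ = m • (ι(ε)^*X₀)_ℂ ∼ m • (ι(ε)_ℂ)^* X₀,ℂ`
  have hsd : ((m • X₀.pullback (Hom.toSchemeHom (ι₁ ε : A₁ ⟶ A₁))).pullback πA).SameDivisor
      (m • (X₀.pullback πA).pullback (Hom.toSchemeHom (Hom.baseChange ℂ (ι₁ ε : A₁ ⟶ A₁)))) := by
    rw [CartierDivisor.pullback_smul]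
    exact sameDivisor_smul (pullback_baseChange_sameDivisor ℂ (ι₁ ε : A₁ ⟶ A₁) πA hπA πA hπA X₀) m
  rw [weilPairingLevel_congr_sameDivisor hsd, weilPairingLevel_smul, weilPairingLevel_pullback]
  rfl

/-- **The averaged divisor `X_s := Σ_{j ∈ s} m_j • ι₁(ε_j)^* X₀`** on `A₁` (built by recursion on the nonempty finite set
`s`): AMPLE when `X₀` is ample and the `m_j` are positive ([GortzWedhorn2020] Prop. 13.50 (4); pull-backs along the
FINITE `ι₁(ε_j)`), and with complex Weil pairings `ē^{X_s,ℂ}(P, Q) = Π_{j ∈ s} ē^{X₀,ℂ}(ι(ε_j)P, ι(ε_j)Q)^{m_j}`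
([MumfordAV1970] §20 (3) and bilinearity of `ē` in the divisor, [Lang1983AbelianVarieties] VII §2 Prop. 3).
[cite: MumfordAV1970, §20 (3) (p. 186)] [cite: Lang1983AbelianVarieties, Ch. VII §2 Prop. 3] [cite: GortzWedhorn2020, Prop. 13.50 (4)] -/
theorem exists_averagedDivisor (hX₀ : X₀.IsAmple) {ι : Type} (ε : ι → 𝓞 K) (hε : ∀ j, ε j ≠ 0) (m : ι → ℕ)
    (hm : ∀ j, 0 < m j) (s : Finset ι) (hs : s.Nonempty) :
    ∃ X : CartierDivisor A₁.X.left, X.IsAmple ∧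
      ∀ (πA : (A₁.baseChange ℂ).X.left ⟶ A₁.X.left) (_hπA : πA = pullback.fst A₁.X.hom (bcSpec k' ℂ)) [IsDominant πA]
        (N : ℕ) [IsDominant (Hom.toSchemeHom ((N : ℤ) • 𝟙 (A₁.baseChange ℂ)))]
        (P Q : (A₁.baseChange ℂ).torsionPoints ℂ N),
        (A₁.baseChange ℂ).weilPairingLevel (X.pullback πA) P Q =
          ∏ j ∈ s, (A₁.baseChange ℂ).weilPairingLevel (X₀.pullback πA)
              ⟨AlgPoints.map (((A₁.endBaseChange ℂ).comp ι₁) (ε j) : A₁.baseChange ℂ ⟶ A₁.baseChange ℂ).hom.hom.hom P.1,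
                map_mem_torsionPoints (((A₁.endBaseChange ℂ).comp ι₁) (ε j) : A₁.baseChange ℂ ⟶ A₁.baseChange ℂ) P.2⟩
              ⟨AlgPoints.map (((A₁.endBaseChange ℂ).comp ι₁) (ε j) : A₁.baseChange ℂ ⟶ A₁.baseChange ℂ).hom.hom.hom Q.1,
                map_mem_torsionPoints (((A₁.endBaseChange ℂ).comp ι₁) (ε j) : A₁.baseChange ℂ ⟶ A₁.baseChange ℂ) Q.2⟩ ^ m j := by
  classical
  -- each summand is ample: `ι₁(ε_j)` is finite (an isogeny)
  have hamp : ∀ j, ∀ [IsDominant (Hom.toSchemeHom (ι₁ (ε j) : A₁ ⟶ A₁))],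
      (m j • X₀.pullback (Hom.toSchemeHom (ι₁ (ε j) : A₁ ⟶ A₁))).IsAmple := by
    intro j _
    haveI : IsFinite (Hom.toSchemeHom (ι₁ (ε j) : A₁ ⟶ A₁)) := (isIsogeny_map_of_ne_zero A₁ ι₁ (hε j)).2
    exact (hX₀.pullback (Hom.toSchemeHom (ι₁ (ε j) : A₁ ⟶ A₁))).smul (hm j)
  induction hs using Finset.Nonempty.cons_induction with
  | singleton a =>
    haveI := (isIsogeny_map_of_ne_zero A₁ ι₁ (hε a)).isDominant_toSchemeHom
    refine ⟨m a • X₀.pullback (Hom.toSchemeHom (ι₁ (ε a) : A₁ ⟶ A₁)), hamp a, fun πA hπA _ N _ P Q => ?_⟩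
    rw [Finset.prod_singleton]
    exact weilPairingLevel_pullback_smul_pullback_map A₁ ι₁ πA hπA X₀ (hε a) (m a) P Q
  | cons a s ha hs ih =>
    obtain ⟨X, hXa, hX⟩ := ih
    haveI := (isIsogeny_map_of_ne_zero A₁ ι₁ (hε a)).isDominant_toSchemeHom
    refine ⟨m a • X₀.pullback (Hom.toSchemeHom (ι₁ (ε a) : A₁ ⟶ A₁)) + X, (hamp a).add hXa, fun πA hπA _ N _ P Q => ?_⟩
    rw [Finset.prod_cons, weilPairingLevel_congr_sameDivisor (CartierDivisor.pullback_add_sameDivisor _ _ πA),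
      weilPairingLevel_add, hX πA hπA N P Q, weilPairingLevel_pullback_smul_pullback_map A₁ ι₁ πA hπA X₀ (hε a) (m a) P Q]

end Averaging

/-! ## §4 (bal) and (nd) for the averaged divisor, in the binder shape of `exists_balancedDivisor_finiteExtension` -/

section Balanced

variable {K : Type} [Field K] [NumberField K] [IsCMField K] {k' : Type} [Field k'] [Algebra k' ℂ]
  (A₁ : AbelianVariety k') (ι₁ : 𝓞 K →+* End A₁)

/-- **The averaged divisor is Rosati-balanced and non-degenerate with bounded radicals** — for ANY abelian variety `A₁`
over a field `k′ ⊂ ℂ` with ANY action `ι₁` of `𝓞_K` (`K` a CM field): given a balanced system of weights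
`(ε_j, m_j)` of `K` (hypothesis `hW`, [Deligne1982] §4 (4.3)(a); H-alg `IsCMField.exists_balancedWeights`) and an ample `X₀`
(tree `exists_isAmple_symmetric_holds`), the divisor `X := Σ_j m_j • ι₁(ε_j)^* X₀` on `A₁` satisfies, on `A₁ ⊗ ℂ` and for
every level `ℓᵏ`: (bal) `ē^{X_ℂ}(ι(a)P, Q) = ē^{X_ℂ}(P, ι(ā)Q)` — the weight identity for the bi-multiplicative
`β(x, y) = ē^{X₀,ℂ}(ι(x)P, ι(y)Q)` — and (nd) `∃ c, (∀ P, ē^{X_ℂ}(P, Q) = 1) → Q^{ℓ^c} = 1` (ampleness of `X_ℂ`,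
[Lang1983AbelianVarieties] VII §2 Prop. 4).  The two clauses are those of `exists_balancedDivisor_finiteExtension` VERBATIM
(with `A₁ = A₀ ⊗ L′`, `ι₁ = ι₀ ⊗ L′`). [cite: Shimura1998, §6.2 Thm. 4 (3) (p. 45); §18.4 (18.4b) (p. 126)]
[cite: Deligne1982, §4 (4.3)(a) and Lemma 4.7] [cite: MumfordAV1970, §20 (3) (p. 186)] [cite: Lang1983AbelianVarieties, Ch. VII §2 Props. 3–4] -/
theorem exists_balancedDivisor_of_balancedWeights
    (hW : ∃ (ι : Type) (_ : Fintype ι) (ε : ι → 𝓞 K) (m : ι → ℕ), Nonempty ι ∧ (∀ j, ε j ≠ 0) ∧ (∀ j, 0 < m j) ∧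
      ∀ (G : Type) [AddCommGroup G] (β : 𝓞 K →+ 𝓞 K →+ G) (a : 𝓞 K),
        ∑ j, m j • β (ε j * a) (ε j) = ∑ j, m j • β (ε j) (ε j * IsCMField.ringOfIntegersComplexConj K a)) :
    ∃ X : CartierDivisor A₁.X.left,
      ∀ (πA : (A₁.baseChange ℂ).X.left ⟶ A₁.X.left) (_hπA : πA = pullback.fst A₁.X.hom (bcSpec k' ℂ)) [IsDominant πA]
        (ℓ : ℕ), 1 < ℓ →
        ∀ [_hdom : ∀ k : ℕ, IsDominant (Hom.toSchemeHom (((ℓ ^ k : ℕ) : ℤ) • 𝟙 (A₁.baseChange ℂ)))],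
        (∀ (k : ℕ) (a : 𝓞 K) (P Q : (A₁.baseChange ℂ).torsionPoints ℂ ((ℓ ^ k : ℕ) : ℤ)),
          (A₁.baseChange ℂ).weilPairingLevel (X.pullback πA)
              ⟨AlgPoints.map (((A₁.endBaseChange ℂ).comp ι₁) a).hom.hom.hom P.1,
                map_mem_torsionPoints (((A₁.endBaseChange ℂ).comp ι₁) a) P.2⟩ Q =
            (A₁.baseChange ℂ).weilPairingLevel (X.pullback πA) P
              ⟨AlgPoints.map (((A₁.endBaseChange ℂ).comp ι₁) (IsCMField.ringOfIntegersComplexConj K a)).hom.hom.hom Q.1,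
                map_mem_torsionPoints (((A₁.endBaseChange ℂ).comp ι₁) (IsCMField.ringOfIntegersComplexConj K a)) Q.2⟩) ∧
        ∃ c : ℕ, ∀ (k : ℕ) (Q : (A₁.baseChange ℂ).torsionPoints ℂ ((ℓ ^ k : ℕ) : ℤ)),
          (∀ P : (A₁.baseChange ℂ).torsionPoints ℂ ((ℓ ^ k : ℕ) : ℤ),
              (A₁.baseChange ℂ).weilPairingLevel (X.pullback πA) P Q = 1) →
            (Q : (A₁.baseChange ℂ).Points ℂ) ^ (ℓ ^ c) = 1 := by
  classical
  obtain ⟨ι, _, ε, m, hne, hε, hm, hWid⟩ := hW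
  -- an ample divisor on `A₁` (Görtz–Wedhorn II, Rem. 27.185)
  obtain ⟨X₀, hX₀, -⟩ := (exists_isAmple_symmetric_holds : A₁.exists_isAmple_symmetric)
  -- the averaged divisor
  obtain ⟨X, hXa, hX⟩ := exists_averagedDivisor A₁ ι₁ X₀ hX₀ ε hε m hm Finset.univ Finset.univ_nonempty
  refine ⟨X, fun πA hπA _ ℓ hℓ _hdom => ⟨fun k a P Q => ?_, ?_⟩⟩
  · -- (bal)
    haveI : IsDominant (Hom.toSchemeHom (((ℓ ^ k : ℕ) : ℤ) • 𝟙 (A₁.baseChange ℂ))) := _hdom k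
    -- the points `ι(x) R` and their algebra
    have hmul : ∀ (x y : 𝓞 K) (R : (A₁.baseChange ℂ).torsionPoints ℂ ((ℓ ^ k : ℕ) : ℤ)),
        (⟨AlgPoints.map (((A₁.endBaseChange ℂ).comp ι₁) (x * y)).hom.hom.hom R.1,
            map_mem_torsionPoints (((A₁.endBaseChange ℂ).comp ι₁) (x * y)) R.2⟩ :
            (A₁.baseChange ℂ).torsionPoints ℂ ((ℓ ^ k : ℕ) : ℤ)) =
          ⟨AlgPoints.map (((A₁.endBaseChange ℂ).comp ι₁) x).hom.hom.hom
              (AlgPoints.map (((A₁.endBaseChange ℂ).comp ι₁) y).hom.hom.hom R.1),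
            map_mem_torsionPoints (((A₁.endBaseChange ℂ).comp ι₁) x)
              (map_mem_torsionPoints (((A₁.endBaseChange ℂ).comp ι₁) y) R.2)⟩ :=
      fun x y R => Subtype.ext (map_hom_map_mul ((A₁.endBaseChange ℂ).comp ι₁) x y R.1)
    have hadd : ∀ (x y : 𝓞 K) (R : (A₁.baseChange ℂ).torsionPoints ℂ ((ℓ ^ k : ℕ) : ℤ)),
        (⟨AlgPoints.map (((A₁.endBaseChange ℂ).comp ι₁) (x + y)).hom.hom.hom R.1,
            map_mem_torsionPoints (((A₁.endBaseChange ℂ).comp ι₁) (x + y)) R.2⟩ :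
            (A₁.baseChange ℂ).torsionPoints ℂ ((ℓ ^ k : ℕ) : ℤ)) =
          ⟨AlgPoints.map (((A₁.endBaseChange ℂ).comp ι₁) x).hom.hom.hom R.1,
              map_mem_torsionPoints (((A₁.endBaseChange ℂ).comp ι₁) x) R.2⟩ *
            ⟨AlgPoints.map (((A₁.endBaseChange ℂ).comp ι₁) y).hom.hom.hom R.1,
              map_mem_torsionPoints (((A₁.endBaseChange ℂ).comp ι₁) y) R.2⟩ :=
      fun x y R => Subtype.ext (map_hom_map_add ((A₁.endBaseChange ℂ).comp ι₁) x y R.1)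
    -- the bi-multiplicative `β(x, y) = ē^{X₀,ℂ}(ι(x) P, ι(y) Q)`, valued in `ℂˣ`
    let e : 𝓞 K → 𝓞 K → ℂˣ := fun x y => Units.mk0
      ((A₁.baseChange ℂ).weilPairingLevel (X₀.pullback πA)
        ⟨AlgPoints.map (((A₁.endBaseChange ℂ).comp ι₁) x).hom.hom.hom P.1,
          map_mem_torsionPoints (((A₁.endBaseChange ℂ).comp ι₁) x) P.2⟩
        ⟨AlgPoints.map (((A₁.endBaseChange ℂ).comp ι₁) y).hom.hom.hom Q.1,
          map_mem_torsionPoints (((A₁.endBaseChange ℂ).comp ι₁) y) Q.2⟩)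
      (weilPairingLevel_ne_zero _ _ _)
    have he : ∀ x y, (e x y : ℂ) = (A₁.baseChange ℂ).weilPairingLevel (X₀.pullback πA)
        ⟨AlgPoints.map (((A₁.endBaseChange ℂ).comp ι₁) x).hom.hom.hom P.1,
          map_mem_torsionPoints (((A₁.endBaseChange ℂ).comp ι₁) x) P.2⟩
        ⟨AlgPoints.map (((A₁.endBaseChange ℂ).comp ι₁) y).hom.hom.hom Q.1,
          map_mem_torsionPoints (((A₁.endBaseChange ℂ).comp ι₁) y) Q.2⟩ := fun x y => rfl
    have he_left : ∀ x x' y, e (x + x') y = e x y * e x' y := fun x x' y => by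
      apply Units.ext
      rw [Units.val_mul, he, he, he, hadd, weilPairingLevel_mul_left]
    have he_right : ∀ x y y', e x (y + y') = e x y * e x y' := fun x y y' => by
      apply Units.ext
      rw [Units.val_mul, he, he, he, hadd, weilPairingLevel_mul_right]
    let β : 𝓞 K →+ 𝓞 K →+ Additive ℂˣ :=
      AddMonoidHom.mk' (fun x => AddMonoidHom.mk' (fun y => Additive.ofMul (e x y)) (fun y y' => by
          change Additive.ofMul (e x (y + y')) = Additive.ofMul (e x y) + Additive.ofMul (e x y')
          rw [he_right]; rfl))
        (fun x x' => by
          refine AddMonoidHom.ext fun y => ?_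
          change Additive.ofMul (e (x + x') y) = Additive.ofMul (e x y) + Additive.ofMul (e x' y)
          rw [he_left]; rfl)
    have hβ : ∀ x y, β x y = Additive.ofMul (e x y) := fun _ _ => rfl
    have hid := congrArg (fun z : Additive ℂˣ => ((Additive.toMul z : ℂˣ) : ℂ)) (hWid (Additive ℂˣ) β a)
    simp only [toMul_sum, toMul_nsmul, hβ, toMul_ofMul, Units.coe_prod, Units.val_pow_eq_pow_val, he] at hid
    -- both sides through the product formula
    rw [hX πA hπA (ℓ ^ k) _ Q, hX πA hπA (ℓ ^ k) P _]
    simp only [← hmul]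
    exact hid
  · -- (nd): `X_ℂ` is ample
    have hℓ0 : ℓ ≠ 0 := by omega
    have hamp : (X.pullback πA).IsAmple := by
      haveI : IsAffineHom πA := by rw [hπA]; exact MorphismProperty.pullback_fst _ _ inferInstance
      exact hXa.pullback πA
    exact exists_radical_pow_eq_one_of_isAmple _ hamp hℓ (Nat.cast_ne_zero.2 hℓ0)

end Balanced

/-! ## §5 Row II-1-S5b from the balanced weights of the CM field -/

section Assembly

/-- **Row II-1-S5b (`exists_balancedDivisor_finiteExtension`) ⟸ balanced weights for every CM field** (H-alg,
`IsCMField.exists_balancedWeights`, [Deligne1982] §4 (4.3)(a)): for a structure `(A₀, ι₀)` over a number field `L ⊂ ℂ` take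
`L′ := L` itself (`⊥`), ANY ample `X₀` on `A₀ ⊗ L′` and the averaged divisor `X := Σ_j m_j • ι(ε_j)^* X₀` (§4) — [Shimura1998]
§6.2 Thm. 4 (3) with §4.1 Prop. 10, AS TYPED, and in fact for every `𝓞_K`-action (the CM-type hypothesis is not used).
[cite: Shimura1998, §6.2 Thm. 4 (3) (p. 45); §4.1 Prop. 10 (p. 23)] [cite: Deligne1982, §4 (4.3)(a) and Lemma 4.7]
[cite: MumfordAV1970, §20 (3) (p. 186)] [cite: Lang1983AbelianVarieties, Ch. VII §2 Props. 3–4] -/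
theorem exists_balancedDivisor_finiteExtension_of_balancedWeights
    (hW : ∀ (K : Type) [Field K] [NumberField K] [IsCMField K],
      ∃ (ι : Type) (_ : Fintype ι) (ε : ι → 𝓞 K) (m : ι → ℕ), Nonempty ι ∧ (∀ j, ε j ≠ 0) ∧ (∀ j, 0 < m j) ∧
        ∀ (G : Type) [AddCommGroup G] (β : 𝓞 K →+ 𝓞 K →+ G) (a : 𝓞 K),
          ∑ j, m j • β (ε j * a) (ε j) = ∑ j, m j • β (ε j) (ε j * IsCMField.ringOfIntegersComplexConj K a)) :
    exists_balancedDivisor_finiteExtension := by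
  intro K _ _ _ Φ L _ _ _ A₀ ι₀ _
  obtain ⟨X, hX⟩ := exists_balancedDivisor_of_balancedWeights (A₀.baseChange ↥(⊥ : IntermediateField L ℂ))
    ((A₀.endBaseChange ↥(⊥ : IntermediateField L ℂ)).comp ι₀) (hW K)
  exact ⟨⊥, inferInstance, X, hX⟩

/-- **Row II-1-S5b is a THEOREM: `exists_balancedDivisor_finiteExtension` holds** — every CM structure `(A₀, ι₀)` of type
`(K, Φ)` over a number field `L ⊂ ℂ` carries, already over `L′ = L`, an AMPLE divisor whose complex Weil pairings are
Rosati-balanced for the multiplications and have bounded radicals ([Shimura1998] §6.2 Thm. 4 (3) «`E(z, T(ξ)w) = E(T(ξ^ρ)z, w)`»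
with §4.1 Prop. 10, AS TYPED in row II-1-S5b): the averaged divisor `Σ_j m_j • ι(ε_j)^* X₀` of §4 for the balanced weights of
`K` (H-alg, `IsCMField.exists_balancedWeights`, [Deligne1982] §4 (4.3)(a) — B-p06).  This discharges the named fact of
`CMBalancedDivisorFiniteExtension` (B-typ02, p603768); the h21 workfile's `stub_balancedDivisor` closes by this name.
[cite: Shimura1998, §6.2 Thm. 4 (3) (p. 45); §4.1 Prop. 10 (p. 23); §18.4 (18.4b) (p. 126)] [cite: Deligne1982, §4 (4.3)(a) and Lemma 4.7]
[cite: MumfordAV1970, §20 (3) (p. 186)] [cite: Lang1983AbelianVarieties, Ch. VII §2 Props. 3–4] -/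
theorem exists_balancedDivisor_finiteExtension_holds : exists_balancedDivisor_finiteExtension :=
  exists_balancedDivisor_finiteExtension_of_balancedWeights IsCMField.exists_balancedWeights

end Assembly

end Literature.NumberTheory.ComplexMultiplication

end
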